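import Mathlib.RingTheory.RootsOfUnity.Basic
import Mathlib.GroupTheory.Torsion
import Mathlib.GroupTheory.QuotientGroup.Defs
import Mathlib.Algebra.Group.Subgroup.Ker
import Mathlib.Data.Fintype.BigOperators
import Literature.IUT.HodgeArakelov.BadPrimeGaussianMonoids

/-!
# [IUTchII] §2, Corollaries 2.5, 2.6, Remarks 2.5.1–2.6.3, Definition 2.7: group-theoretic theta
# evaluation on the subgraph `Γ^▶`, theta values `q_v^{j²}`, splittings at the zero label

S. Mochizuki, *Inter-universal Teichmüller theory II*, §2 "Galois-theoretic theta evaluation"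
(kurims Dec-2020 manuscript): Corollary 2.5 (i)–(iii) (pp. 71–72), Remark 2.5.1 (i)–(iii)
(pp. 72–73), Remark 2.5.2 (i)–(iv) (pp. 73–75), Corollary 2.6 (i)–(ii) (p. 76), Remark 2.6.1
(i)–(ii) (pp. 76–77), Remark 2.6.2 (i)–(iii) (pp. 77–78), Remark 2.6.3 (i)–(v) (pp. 79–80),
Definition 2.7 (i)–(ii) (pp. 80–81) [cite: Mochizuki2012, Cor 2.5 p.71]. Typed by abc-iut-L6-t2
under the idle-typer CLAIM protocol (plan/L6/ASSIGNMENTS.md §5 v1.4, BLOCK B; minted owner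
abc-iut-L6-t1). Claim key DISPUTED (D-0012): definitions, interfaces and Prop-valued statements
only; nothing asserted.

**What is printed (the concrete kernel).** Remark 2.5.1 (i) p. 72: "for `j ∈ |F_l|`, the set
`θ^j(Π_{v¨▶})` consists of precisely the `μ_{2l}`-orbit of the theta value `q_v^{j²}` … where the
`j` in the exponent denotes the element `∈ {0, 1, …, l⋇}` determined by" `j`; Remark 2.5.1 (iii)
p. 73: "the various `μ_{2l}`-multiple indeterminacies that occur, for various `j ∈ |F_l|`, in the
`μ_{2l}`-orbit `θ^j(Π_{v¨▶})` are independent … not «synchronized» so as to arise from a single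
indeterminacy that is independent of `j`"; Corollary 2.6 (ii) p. 76: at the zero label "the set
`θ^t(Π^γ_{v¨▶})` … is equal to the `μ_{2l}`-orbit of the identity element"; Definition 2.7 (ii) p. 81:
`Π_{M^Θ_*¨▶} ⊆ Π_{M^Θ_*▶} ⊆ Π_{M^Θ_*}` "the respective inverse images of `Π_{v¨▶} ⊆ Π_{v▶} ⊆ Π_v`" under
`Π_{M^Θ_*} → Π_X(M^Θ_*)`, whose "kernel may be identified with the exterior cyclotome `Π_μ(M^Θ_*)`"
(Def 2.7 (i)), and the subquotients / restricted cyclotomic rigidity isomorphism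
`(l·Δ_Θ)(M^Θ_*¨▶) ⥲ Π_μ(M^Θ_*¨▶)`.

**Constructed and proved.** Over an abstract commutative group `H` (the cohomology module
`lim_J H¹(G_v(Π^γ_{v¨▶})|_J, (l·Δ_Θ)(Π^γ_{v¨▶}))`, multiplicative notation) with exactly `2l` roots of unity
of order dividing `2l` and an element `q` ("`q_v`"): the theta-value orbits `θ^j = μ_{2l}·q^{j²}`
(`thetaValueAt`), `card θ^j = 2l` (`card_thetaValueAt`), `θ^0 = μ_{2l}` (`thetaValueAt_zero`, Cor 2.6
(ii)), the `ValueProfileData` of the Cor 3.5 file BUILT from `q` (`valueProfileDataOfQ` — this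
instantiates the TODO-merge input of `BadPrimeGaussianMonoids` at the level of Remark 2.5.1 (i)),
hence `(2l)^{l⋇}` value-profiles (`card_valueProfiles_ofQ`), versus at most `2l` synchronized ones
(`card_synchronizedProfiles_le`) — the independence of Remark 2.5.1 (iii) in numbers; Definition
2.7 as real `Subgroup.comap`s with `ker ≤ Π_{M^Θ_*¨▶}` (`ker_le_preimageDD`).

**Interfaces, SLOT-ONLY** (fields of type `Prop`, instantiable by `True`, not counted as typed
content; ref-b B7 convention): the reconstruction / restriction / compatibility clauses of
Cor 2.5 (i)–(iii), 2.6 (i)–(ii) and Remarks 2.5.1 (ii), 2.5.2, 2.6.1 (conjugate synchronization),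
2.6.2, 2.6.3 (i),(iii)–(v), whose inputs (`Π_v`, `Π_{v▶}`, `Π_{v¨▶}`, `Π̂^±_v`, `I_t`, `D^δ_{t,μ_−}`,
`θ^ι(Π^γ_v)` of Props 2.1–2.4; [IUTchI] §6) are not in the tree. Remark 2.6.3 (ii) (the quantity
`‖Γ'‖` and its monotonicity (d)) is typed and PROVED in the sibling file `ThetaSubgraphNorm`.
-- TODO-merge: abc-iut-L6-t1 (Props 2.1, 2.2, Def 2.3, Cor 2.4 — `ThetaSetting`/`MonoThetaEnv` of
-- p403770), abc-iut-L2-t1 ([EtTh] Prop 1.4 theta series), abc-iut-L5-t4 ([IUTchI] Def 6.1, 6.4,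
-- Prop 6.8), abc-iut-L5-t1 ([IUTchI] Cor 2.3, Prop 2.4).
-/

namespace Literature.IUT.HodgeArakelov

open scoped BigOperators

universe u v

/-! ### 1. Remark 2.5.1 (i), Cor 2.5 (ii), Cor 2.6 (ii): the theta values `μ_{2l} · q_v^{j²}` -/

section ThetaValues

variable {H : Type u} [CommGroup H] [DecidableEq H] (twoL : ℕ) [Fintype (rootsOfUnity twoL H)]

/-- `θ^j(Π_{v¨▶})`: "precisely the `μ_{2l}`-orbit of the theta value `q_v^{j²}`" ([IUTchII] Rmk 2.5.1 (i)
p. 72; the `μ_{2l}`-orbits of Cor 2.5 (ii) p. 71–72), for the natural number `j ∈ {0, 1, …, l⋇}` of a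
label `j ∈ |F_l|`, inside the cohomology module `H`. [cite: Mochizuki2012, Rmk 2.5.1 (i) p.72] -/
def thetaValueAt (q : H) (j : ℕ) : Finset H :=
  Finset.univ.image fun ζ : rootsOfUnity twoL H => ((ζ : Hˣ) : H) * q ^ (j ^ 2)

/-- Membership in `θ^j`: `x = ζ · q^{j²}` with `ζ^{2l} = 1`. [cite: Mochizuki2012, Rmk 2.5.1 (i) p.72] -/
theorem mem_thetaValueAt (q : H) (j : ℕ) (x : H) :
    x ∈ thetaValueAt twoL q j ↔ ∃ ζ : rootsOfUnity twoL H, x = ((ζ : Hˣ) : H) * q ^ (j ^ 2) := by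
  unfold thetaValueAt
  simp only [Finset.mem_image, Finset.mem_univ, true_and]
  constructor
  · rintro ⟨ζ, h⟩; exact ⟨ζ, h.symm⟩
  · rintro ⟨ζ, h⟩; exact ⟨ζ, h.symm⟩

/-- Each `θ^j` is a `μ_{2l}`-orbit with exactly `|μ_{2l}|` elements (a "`μ_{2l}`-orbit of elements",
Cor 2.5 (ii) p. 71): multiplication by `q^{j²}` is injective. [cite: Mochizuki2012, Cor 2.5 (ii) p.71] -/
theorem card_thetaValueAt (q : H) (j : ℕ) :
    (thetaValueAt twoL q j).card = Fintype.card (rootsOfUnity twoL H) := by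
  unfold thetaValueAt
  rw [Finset.card_image_of_injective _ ?_, Finset.card_univ]
  intro ζ ζ' h
  have h' : ((ζ : Hˣ) : H) = ((ζ' : Hˣ) : H) := mul_right_cancel h
  exact Subtype.ext (Units.ext h')

/-- **Cor 2.6 (ii) p. 76**: at the zero label "the set `θ^t(Π^γ_{v¨▶})` … is equal to the `μ_{2l}`-orbit
of the identity element". [cite: Mochizuki2012, Cor 2.6 (ii) p.76] -/
theorem thetaValueAt_zero (q : H) :
    thetaValueAt twoL q 0 = Finset.univ.image fun ζ : rootsOfUnity twoL H => ((ζ : Hˣ) : H) := by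
  unfold thetaValueAt
  congr 1
  funext ζ
  simp

/-- The `ValueProfileData` of Cor 3.5 (ii) (`BadPrimeGaussianMonoids`) BUILT from the theta values
of Remark 2.5.1 (i): at the label with natural number `j = i + 1`, `i : Fin lstar`, the orbit
`μ_{2l} · q^{j²}` — this instantiates that file's TODO-merge input at the level of Remark 2.5.1 (i)
(given exactly `2l` roots of unity of order dividing `2l` in `H`). [cite: Mochizuki2012, Rmk 2.5.1 (i) p.72] -/
def valueProfileDataOfQ (lstar : ℕ) (q : H)
    (hcard : Fintype.card (rootsOfUnity twoL H) = twoL) :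
    ValueProfileData (Fin lstar) H twoL where
  thetaValues i := thetaValueAt twoL q (i.val + 1)
  card_thetaValues i := by rw [card_thetaValueAt, hcard]
  orbit i a ha b hb := by
    rw [mem_thetaValueAt] at ha hb
    obtain ⟨ζ, rfl⟩ := ha
    obtain ⟨ζ', rfl⟩ := hb
    refine ⟨(ζ : Hˣ) * (ζ' : Hˣ)⁻¹, ?_, ?_⟩
    · have h1 : ((ζ : Hˣ) * (ζ' : Hˣ)⁻¹) ∈ rootsOfUnity twoL H :=
        Subgroup.mul_mem _ ζ.2 (Subgroup.inv_mem _ ζ'.2)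
      exact (mem_rootsOfUnity _ _).mp h1
    · simp only [Units.val_mul, Units.val_inv_eq_inv_val]
      rw [mul_assoc, ← mul_assoc ((ζ' : Hˣ) : H)⁻¹, inv_mul_cancel, one_mul]

/-- Hence, by Cor 3.5 (ii) as typed in `BadPrimeGaussianMonoids`, the theta values of Remark 2.5.1
(i) give exactly `(2l)^{l⋇}` value-profiles. [cite: Mochizuki2012, Cor 3.5 (ii) p.94] -/
theorem card_valueProfiles_ofQ (lstar : ℕ) (q : H)
    (hcard : Fintype.card (rootsOfUnity twoL H) = twoL) :
    (valueProfileDataOfQ twoL lstar q hcard).valueProfiles.card = twoL ^ lstar := by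
  rw [ValueProfileData.card_valueProfiles, Fintype.card_fin]

/-- The SYNCHRONIZED profiles `j ↦ ζ · q^{j²}` with ONE `ζ ∈ μ_{2l}` for all labels — what the
indeterminacies would be if they arose "from a single indeterminacy that is independent of `j`"
([IUTchII] Rmk 2.5.1 (iii) p. 73). [cite: Mochizuki2012, Rmk 2.5.1 (iii) p.73] -/
def synchronizedProfiles (lstar : ℕ) (q : H) : Finset (Fin lstar → H) :=
  Finset.univ.image fun ζ : rootsOfUnity twoL H => fun i : Fin lstar =>
    ((ζ : Hˣ) : H) * q ^ ((i.val + 1) ^ 2)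

/-- **Remark 2.5.1 (iii) p. 73 in numbers**: there are at most `2l` synchronized profiles (against
`(2l)^{l⋇}` value-profiles, `card_valueProfiles_ofQ`): the `μ_{2l}`-indeterminacies at the various
labels "are independent", "not «synchronized»". [cite: Mochizuki2012, Rmk 2.5.1 (iii) p.73] -/
theorem card_synchronizedProfiles_le (lstar : ℕ) (q : H) :
    (synchronizedProfiles twoL lstar q).card ≤ Fintype.card (rootsOfUnity twoL H) := by
  unfold synchronizedProfiles
  exact Finset.card_image_le.trans (by rw [Finset.card_univ])

/-- Every synchronized profile is a value-profile (the diagonal indeterminacy is among the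
independent ones). [cite: Mochizuki2012, Rmk 2.5.1 (iii) p.73] -/
theorem synchronizedProfiles_subset (lstar : ℕ) (q : H)
    (hcard : Fintype.card (rootsOfUnity twoL H) = twoL) :
    synchronizedProfiles twoL lstar q ⊆ (valueProfileDataOfQ twoL lstar q hcard).valueProfiles := by
  intro ξ hξ
  rw [ValueProfileData.mem_valueProfiles]
  unfold synchronizedProfiles at hξ
  simp only [Finset.mem_image, Finset.mem_univ, true_and] at hξ
  obtain ⟨ζ, rfl⟩ := hξ
  intro i
  exact (mem_thetaValueAt twoL q (i.val + 1) _).mpr ⟨ζ, rfl⟩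

end ThetaValues

/-! ### 2. Definition 2.7: `Π_{M^Θ_*}`, its subgroups `Π_{M^Θ_*¨▶} ⊆ Π_{M^Θ_*▶}`, and subquotients -/

section Def27

variable {P : Type u} {Q : Type v} [Group P] [Group Q]

/-- INPUT DATA of Definition 2.7 (pp. 80–81): the inverse limit `Π_{M^Θ_*}` of the projective system
of topological groups of a projective system of mono-theta environments `M^Θ_*` with
`Π_X(M^Θ_*) ≅ Π_v`, "a natural homomorphism of topological groups `Π_{M^Θ_*} → Π_X(M^Θ_*)` whose kernel
may be identified with the exterior cyclotome `Π_μ(M^Θ_*)`, and whose image is the subgroup …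
determined by `Π^tp_{Y_v}`" (Def 2.7 (i)), together with the subgroups `Π_{v¨▶} ⊆ Π_{v▶} ⊆ Π_v`
(Def 2.3 (ii); Remark 2.1.1) and the image `Π^tp_{Y_v}`. Topologies suppressed.
-- TODO-merge: abc-iut-L6-t1 (Def 1.1, Prop 1.5 `M^Θ_*`; Def 2.3 `Π_{v▶}`, `Π_{v¨▶}`), abc-iut-L2-t2
-- ([EtTh] Def 2.13 mono-theta environments). [cite: Mochizuki2012, Def 2.7 (i) p.81] -/
structure MonoThetaProjData (P : Type u) (Q : Type v) [Group P] [Group Q] where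
  /-- `Π_{M^Θ_*} → Π_X(M^Θ_*) ≅ Π_v` -/
  proj : P →* Q
  /-- `Π_{v▶} ⊆ Π_v` -/
  PivD : Subgroup Q
  /-- `Π_{v¨▶} ⊆ Π_{v▶}` -/
  PivDD : Subgroup Q
  /-- the inclusion `Π_{v¨▶} ⊆ Π_{v▶}` -/
  dd_le_d : PivDD ≤ PivD
  /-- `Π^tp_{Y_v} ⊆ Π_v`, the image of `proj` (Def 2.7 (i)) -/
  PiY : Subgroup Q
  /-- "whose image is the subgroup … determined by `Π^tp_{Y_v}`" -/
  range_eq : proj.range = PiY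

namespace MonoThetaProjData

variable (D : MonoThetaProjData P Q)

/-- `Π_μ(M^Θ_*)`: "whose kernel may be identified with the exterior cyclotome" ([IUTchII] Def 2.7 (i)
p. 81) — the kernel of `Π_{M^Θ_*} → Π_X(M^Θ_*)`. [cite: Mochizuki2012, Def 2.7 (i) p.81] -/
def exteriorCyclotome : Subgroup P := D.proj.ker

/-- `Π_{M^Θ_*▶} ⊆ Π_{M^Θ_*}`: the inverse image of `Π_{v▶}` ([IUTchII] Def 2.7 (ii) p. 81).
[cite: Mochizuki2012, Def 2.7 (ii) p.81] -/
def preimageD : Subgroup P := D.PivD.comap D.proj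

/-- `Π_{M^Θ_*¨▶} ⊆ Π_{M^Θ_*▶}`: the inverse image of `Π_{v¨▶}` ([IUTchII] Def 2.7 (ii) p. 81).
[cite: Mochizuki2012, Def 2.7 (ii) p.81] -/
def preimageDD : Subgroup P := D.PivDD.comap D.proj

/-- `Π_{M^Θ_*¨▶} ⊆ Π_{M^Θ_*▶}` ([IUTchII] Def 2.7 (ii) p. 81). [cite: Mochizuki2012, Def 2.7 (ii) p.81] -/
theorem preimageDD_le_preimageD : D.preimageDD ≤ D.preimageD :=
  Subgroup.comap_mono D.dd_le_d

/-- The exterior cyclotome lies in `Π_{M^Θ_*¨▶}`, so the subquotient `Π_μ(M^Θ_*¨▶)` of `Π_{M^Θ_*¨▶}`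
"determined by the subquotient `Π_μ(M^Θ_*)`" ([IUTchII] Def 2.7 (ii) p. 81) is the same group, and the
restricted cyclotomic rigidity isomorphism `(l·Δ_Θ)(M^Θ_*¨▶) ⥲ Π_μ(M^Θ_*¨▶)` has the same source and
target as that of Prop 1.5 (iii). [cite: Mochizuki2012, Def 2.7 (ii) p.81] -/
theorem ker_le_preimageDD : D.exteriorCyclotome ≤ D.preimageDD := by
  intro x hx
  rw [exteriorCyclotome, MonoidHom.mem_ker] at hx
  simp [preimageDD, Subgroup.mem_comap, hx]

/-- `Π_{v¨▶}(M^Θ_*¨▶)`: the image of `Π_{M^Θ_*¨▶}` in `Π_v`, i.e. `Π_{v¨▶} ∩ Π^tp_{Y_v}`-part reached by `proj`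
(the subquotient "determined by … `Π_{v¨▶}`", Def 2.7 (ii) p. 81). [cite: Mochizuki2012, Def 2.7 (ii) p.81] -/
def imageDD : Subgroup Q := D.preimageDD.map D.proj

/-- The image of `Π_{M^Θ_*¨▶}` lies in `Π_{v¨▶}`. [cite: Mochizuki2012, Def 2.7 (ii) p.81] -/
theorem imageDD_le : D.imageDD ≤ D.PivDD := Subgroup.map_comap_le _ _

end MonoThetaProjData

/-- INTERFACE (the subquotient bookkeeping of [IUTchII] Cor 2.5 (i) p. 71 and Def 2.7 (ii) p. 81): a
subquotient `A/B` of a group ("the subquotient `(l·Δ_Θ)(Π_v)` of `Π_v`", Prop 1.4 / Def 2.3), as a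
pair of subgroups with `B` normal in `A`. [cite: Mochizuki2012, Cor 2.5 (i) p.71] -/
structure Subquotient (Q : Type v) [Group Q] where
  /-- the larger subgroup -/
  top : Subgroup Q
  /-- the smaller subgroup -/
  bot : Subgroup Q
  /-- `bot ≤ top` -/
  le : bot ≤ top
  /-- `bot` is normal in `top` (as a subgroup of the subtype) -/
  normal : (bot.subgroupOf top).Normal

/-- **Cor 2.5 (i) p. 71, the bookkeeping proved**: if the subquotient `(l·Δ_Θ)(Π_v) = A/B` of `Π_v`
has `A ⊆ Π_{v¨▶}` (as happens "by considering the cuspidal inertia groups involved", proof on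
p. 72), then intersecting with `Π_{v¨▶}` changes nothing: "the inclusion `Π_{v¨▶} ↪ Π_v` induces an
isomorphism `(l·Δ_Θ)(Π_{v¨▶}) ⥲ (l·Δ_Θ)(Π_v)`". [cite: Mochizuki2012, Cor 2.5 (i) p.71] -/
theorem Subquotient.inf_eq_of_le {Q : Type v} [Group Q] (S : Subquotient Q) (H : Subgroup Q)
    (h : S.top ≤ H) : S.top ⊓ H = S.top ∧ S.bot ⊓ H = S.bot :=
  ⟨inf_eq_left.mpr h, inf_eq_left.mpr (S.le.trans h)⟩

end Def27

/-! ### 3. `M^{×μ}_TM` (Cor 2.6 (i)) -/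

/-- `M^{×μ}_TM(Π^γ_{v¨▶}) := M^×_TM(Π^γ_{v¨▶})/M^μ_TM(Π^γ_{v¨▶})`, "where `M^μ_TM … denotes the submodule of torsion
elements" ([IUTchII] Cor 2.6 (i) p. 76), for `M^×_TM` a subgroup of the (multiplicatively written)
cohomology module. [cite: Mochizuki2012, Cor 2.6 (i) p.76] -/
abbrev unitsModTorsionOf {H : Type u} [CommGroup H] (U : Subgroup H) : Type u :=
  U ⧸ CommGroup.torsion U

/-! ### 4. SLOT-ONLY interfaces for the remaining clauses -/

/-- INTERFACE, SLOT-ONLY (every field has type `Prop`, is instantiable by `True`, and is not counted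
as typed content): [IUTchII] Cor 2.5 (i)–(iii) pp. 71–72 and Cor 2.6 (i)–(ii) p. 76 beyond §1–§3
above, over the inputs of Cor 2.4 (`Π_v`, `Π̂^±_v`, `I^δ_t`, `D^δ_{t,μ_−}`, `Π^γ_{v¨▶}`, `θ^ι(Π^γ_v)`). Quoted,
not asserted. -- TODO-merge: abc-iut-L6-t1 (Cor 2.4, Prop 2.2 (ii), Prop 1.4, Cor 1.12).
[cite: Mochizuki2012, Cor 2.5 p.71] -/
structure Cor25Cor26Statements where
  /-- 2.5 (i) p. 71: "a functorial group-theoretic algorithm for constructing these quotients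
  [`Π_v ↠ G_v(Π_v)`, `Π_{v¨▶} ↠ G_v(Π_{v¨▶})`] from the topological group `Π_v` [cf. [AbsAnab], Lemma 1.3.8 …]". -/
  quotientsReconstructible : Prop
  /-- 2.5 (ii) pp. 71–72: "restriction of the `ι^γ`-invariant sets `θ^ι(Π^γ_v)`, `∞θ^ι(Π^γ_v)` … to the
  subgroup `Π^γ_{v¨▶}` … yields `μ_{2l}`-, `μ`-orbits of elements `θ^ι(Π^γ_{v¨▶}) ⊆ ∞θ^ι(Π^γ_{v¨▶}) ⊆
  lim_{Ĵ} H¹(Π^γ_{v¨▶}|_Ĵ, (l·Δ_Θ)(Π^γ_{v¨▶}))` … which, upon further restriction to the decomposition groups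
  `D^δ_{t,μ_−}` …, yield `μ_{2l}`-, `μ`-orbits of elements `θ^t(Π^γ_{v¨▶}) ⊆ ∞θ^t(Π^γ_{v¨▶}) ⊆
  lim_{J_G} H¹(G_v(Π^γ_{v¨▶})|_{J_G}, (l·Δ_Θ)(Π^γ_{v¨▶}))`"; "the sets … depend only on the label `|t| ∈ |F_l|`"
  (= `thetaValueAt` by Remark 2.5.1 (i)). -/
  restrictionToEvaluationPoints : Prop
  /-- 2.5 (iii) p. 72: "a group-theoretic algorithm for constructing the collections of `μ_{2l}`-,
  `μ`-orbits `{θ^{|t|}(Π^γ_{v¨▶})}_{|t| ∈ |F_l|}`, `{∞θ^{|t|}(Π^γ_{v¨▶})}_{|t| ∈ |F_l|}` which is functorial in the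
  topological group `Π_v` and, moreover, compatible with the independent conjugacy actions of
  `Δ̂^±_v` on the sets `{I^{γ₁}_t}_{γ₁ ∈ Π̂^±_v}` … and `{Π^{γ₂}_{v¨▶}}_{γ₂ ∈ Π̂^±_v}`". -/
  functorialEvaluation : Prop
  /-- 2.6 (i) p. 76: the subsets `M^×_TM(Π^γ_{v¨▶}) ⊆ lim H¹(…)`, `M^×_TM·θ^ι(Π^γ_{v¨▶}) ⊆ M^×_TM·∞θ^ι(Π^γ_{v¨▶})`
  "compatible, relative to the first restriction operation …, with the corresponding subsets … of
  Proposition 1.4 and Corollary 1.12". -/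
  unitsOnSubgraphs : Prop
  /-- 2.6 (ii) p. 76: "restriction to the decomposition groups `D^δ_{t,μ_−}` … determines splittings
  `M^{×μ}_TM(Π^γ_{v¨▶}) × {∞θ^ι(Π^γ_{v¨▶})/M^μ_TM(Π^γ_{v¨▶})}` of `M^×_TM·∞θ^ι(Π^γ_{v¨▶})/M^μ_TM(Π^γ_{v¨▶})` which are
  compatible … with the splittings of Corollary 1.12, (ii)" (at the zero label, where
  `θ^t` is the `μ_{2l}`-orbit of the identity: `thetaValueAt_zero`). -/
  zeroLabelSplitting : Prop

/-- INTERFACE, SLOT-ONLY: [IUTchII] Remark 2.5.1 (ii) p. 73 and Remark 2.5.2 (i)–(iv) pp. 73–75.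
Quoted, not asserted. -- TODO-merge: abc-iut-L2-t1 ([EtTh] Prop 1.4), abc-iut-L5-t3 ([IUTchI]
-- Rmk 4.5.1), abc-iut-L5-t4 ([IUTchI] Def 6.1, 6.4). [cite: Mochizuki2012, Rmk 2.5.2 p.73] -/
structure Remark251252Statements where
  /-- 2.5.1 (ii) p. 73: the theta values are the values `Θ̈(±√−1 · q_X^{j/2})`, `j ∈ {0,…,l⋇}`, of the
  theta series `Θ̈ = q_X^{−1/8} · Σ_{n ∈ ℤ} (−1)^n · q_X^{(1/2)(n+1/2)²} · Ü^{2n+1}` ([EtTh] Prop 1.4), and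
  satisfy "the crucial property": "the ratio `Θ̈(c)/Θ̈(c')` is a root of unity, for any `c' ∈ K_v` …
  that occurs as the result of applying an automorphism of `Π_v` to … `c` such that `c'/c` is a
  unit". -/
  thetaSeriesValues : Prop
  /-- 2.5.2 (i) pp. 73–74: the inclusions `I^{γ₁}_t ↪ Π^{γ₂}_{v¨▶}` as "a sort of morphism between
  quotients" by `Δ̂^±_v`; "the subgroups `Π_{v▶}, Π_{v¨▶} ⊆ Π̂^±_v` are far from being normal". -/
  quotientInterpretation : Prop
  /-- 2.5.2 (ii) p. 74: `Π^{⊚±} := Π_{X_K}`, `Δ^{⊚±} := Δ_X`, "naturally identified, up to inner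
  automorphism, with `Δ̂^±_v`", "independent of `v`", recoverable "from the global portion `†D^{⊚±}`",
  serving as a "«common bridge» between local data … and global data such as the labels". -/
  globalBridge : Prop
  /-- 2.5.2 (iii) pp. 74–75: "neither of the natural surjections `Π̂^±_v ↠ G_v`, `Π^{⊚±} ↠ G_K` admits
  a section that simultaneously normalizes the subgroups `I_t`"; hence "`G_v`-conjugacy indeterminacy
  ⟹ `Δ̂^±_v`-conjugacy indeterminacy", "`G_K`-conjugacy indeterminacy ⟹ `Δ^{⊚±}`-conjugacy
  indeterminacy"; "`Δ̂^cor_v ↠ Δ̂^cor_v/Δ̂^±_v` does not admit a splitting" ⟹ "independent …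
  conjugacy indeterminacies on the subgroups `I_t`, for distinct `t`"; "`G_v` does not determine a
  direct summand of `G_K`" ⟹ "`G_K`-conjugacy indeterminacy ⟹ independent `G_v`-conjugacy
  indeterminacies". -/
  independentConjugacyIndeterminacies : Prop
  /-- 2.5.2 (iv) p. 75 (Fig. 2.1): two lines with "independent actions by groups of horizontal
  translations"; "there is no way to separate … the inclusion of a «∘» into a «•→•» as the left-hand
  «•» from the inclusion of the same «∘» into some «•→•» as the right-hand «•»". -/
  figure21 : Prop

/-- INTERFACE, SLOT-ONLY: [IUTchII] Remark 2.6.1 (i)–(ii) pp. 76–77 (**conjugate synchronization**)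
and Remark 2.6.2 (i)–(iii) pp. 77–78. Quoted, not asserted. -- TODO-merge: abc-iut-L5-t4 ([IUTchI]
-- Def 6.4, Prop 6.8, Rmk 6.12.4–6.12.6). [cite: Mochizuki2012, Rmk 2.6.1 p.76] -/
structure Remark261262Statements where
  /-- 2.6.1 (i) pp. 76–77: the evaluation algorithm "is performed relative to a single basepoint";
  the theta values `θ^{|t|}(Π^γ_{v¨▶}) ⊆ H¹(G_v(Π^γ_{v¨▶}), (l·Δ_Θ)(Π^γ_{v¨▶}))` "for various `|t| ∈ |F_l|` are all
  computed relative to the single copy [… independent of `|t|`!] of the Galois group `G_v(Π^γ_{v¨▶})`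
  and the single cyclotome `(l·Δ_Θ)(Π^γ_{v¨▶})`" — "We shall refer to this phenomenon by the term
  conjugate synchronization." -/
  conjugateSynchronization : Prop
  /-- 2.6.1 (ii) p. 77: the theta values "be treated as a single unified entity, whose Kummer theory
  may be described by considering the action of a single Galois group … relative to a single
  cyclotome"; compatibility "with the «log-wall»". -/
  unifiedKummerTheory : Prop
  /-- 2.6.2 (i) pp. 77–78, (a)–(c): `Π_v` "as the tempered fundamental group of `†D_{≻,v}`", `Π̂^±_v` "as
  the commensurator of the closure of `Π_v` … inside the profinite fundamental group of `†D^{⊚±}`",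
  the `Δ̂^±_v`-outer action of `F_l^⋊±` "as corresponding to the `F_l^⋊±`-symmetry of [IUTchI],
  Proposition 6.8, (i)"; "the conjugate synchronization … is compatible with the `F_l^⋊±`-symmetry". -/
  compatibleWithFlPlusMinusSymmetry : Prop
  /-- 2.6.2 (ii) p. 78: "incompatibility of the conjugate synchronization basepoint … with the
  `F_l^⋇`-symmetry", which "involves permuting multiple copies of local geometric objects … at the
  expense of … «label crushing»". -/
  incompatibleWithFlStarSymmetry : Prop
  /-- 2.6.2 (iii) p. 78: the `F_l^⋊±`-symmetry "allows comparison with the label zero", hence with the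
  copies of "`O^×_k`" in the splittings of Cor 1.12 (ii) — "precisely the content of Corollary 2.6". -/
  comparisonWithZeroLabel : Prop

/-- INTERFACE, SLOT-ONLY: [IUTchII] Remark 2.6.3 (i), (iii)–(v) pp. 79–80 (the quantity `‖Γ'‖` of
(ii) and its monotonicity (d) are typed and proved in `ThetaSubgraphNorm`). Quoted, not asserted.
[cite: Mochizuki2012, Rmk 2.6.3 p.79] -/
structure Remark263Statements where
  /-- (i) p. 79: for another subgraph `Γ'` of `Γ_Ÿ` ("a copy of the real line `ℝ`" with vertices `ℤ`),
  "(a) this subgraph `Γ'` must be connected", "(b) this subgraph `Γ'` must contain the vertex …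
  labeled «0»". -/
  connectedContainsZero : Prop
  /-- (iii) p. 80: "the case of infinite `Γ'` may be excluded without loss of generality". -/
  finiteWlog : Prop
  /-- (iv) p. 80: the indeterminacies arising "when a fiber of `Γ'` over `|F_l|` contains more than one
  element are … fundamentally incompatible with the product formula. … the only choice for `Γ'` that
  is compatible with the «globalization via the product formula» … is `Γ^▶_Ÿ`". -/
  productFormulaForcesGammaArrow : Prop
  /-- (v) p. 80: "the collection of values «`q_v^{j²}`» … determined by the subgraph `Γ^▶_Ÿ` is of a highly
  distinguished nature … essentially determined … by the requirement of maximizing the quantity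
  «`‖Γ'‖`» in a fashion compatible with the global product formula". -/
  distinguishedValues : Prop

end Literature.IUT.HodgeArakelov
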